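import Summits.QuantumFields.YangMills.Theorems.UnitScaleTiltProp7SectET3NormG
import Summits.QuantumFields.YangMills.Theorems.UnitScaleTiltProp7SectET3Letters
import Literature.MathematicalPhysics.QuantumFieldTheory.Balaban1983to89.B9Thm313WholeLeafCoGlob
import HarnessLib

/-!
# Route `UnitScaleTilt`, crux «MinimiserStabilityRegPr» (stmt-QuantumFields-19200, v10 stub EX, route (α), node N06(d = 3)) — layer (S3-b), the (3.47) UPGRADE OF THE T³ LEAF:
# **`B9.Thm313Printed` AT THE T³ INDEX WITH THE GLOBAL ENTRIES (3.47)₀,₁,₂ OF 𝔊 PROVED INSIDE** (Track A's `_coGlob` species `B9Thm313WholeLeafCoGlob.thm313Printed_of_stepDG` read at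
# d + 1 = 3), and **THE DISPLAYED `norm_G` ROW OF C-min FROM THE DISPLAYED N06(d = 3) OBLIGATIONS** with NO displayed (3.47) — ONE kernel statement

Cell `ym3-torus` (HUMAN RULING D-0037, YM ladder rung R3 — NOT the Clay problem), width seat ym-ust-20520-w1 g3 (OWNER 02:57:14Z (5): (S3-b)-G primary).  Count-neutral helper
(`--supports stmt-QuantumFields-19200 --as helper`); registry untouched; THEOREMS ONLY (0 `def`, 0 `sorry`); NOTHING of [Balaban1985BackgroundPropagators] is asserted.

WHY.  ★w1 g2's leaf `Prop7SectET3N06Leaves.t313_of_pins_T3` (species `thm313Printed_of_step`) carries the (3.47) clause of `GG` INSIDE ITS DISPLAYED RESIDUAL `hres` — and (3.47)₁ at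
`γ = −3` is exactly what `SectEDatum.norm_G` reads (`Prop7SectET3NormG.normG_of_thm313Printed`, ✓ p600795).  Along that species the DEPMAP edge «N06(d = 3) → norm_G» is therefore
«displayed (3.47) → norm_G».  Print (p. 398): *«It is easy to see that the global inequalities (3.47) are consequences of the local ones (3.42) and Lemma 2.1.»* — kernel-checked by
seat n06-l as `B9Thm313WholeLeafCoGlob.thm313Printed_of_stepDG` (the (3.47) members of 𝔊 at the entries 0, 1, 2 from the [4]-(2.51) block majorants of the MODEL operators
`𝔊(U)`, `∇_U∘𝔊(U)`, `𝔊(U)∘∇*_U` that the leaf proves from the letters, one scale transfer (2.60) and one row sum (2.61) per entry, through CO-READINGS `B9Ineq347CoReading.CoReadsGlob`).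
THIS FILE reads that leaf at the T³ index exactly as ★w1 g2 read `_of_step`: §1 ★★ `t313_of_pins_T3_coGlob` — at `I := KIdx 2 ℓ hd3 hL b₀ b₁`, `geo := geo9K`, `bg := bgT3`, `R₀ ≡ 1`
(the record's `R := 1`), with the GEOMETRY rows DISCHARGED by ★w3-20520 g2's `Prop7SectET3Geometry` (`geoOK_geo9K`, `modelSignsOn_geo9K`, `geo9K_one_le_L`, `geo9K_L_le` (Lc := ℓ + 1),
`geo9K_eta_pos`, `rowSum261_geo9K` at the rate `σ > 0` (constant floored at 0), `lemma21AboveG_geo9K` at the weight exponent `α := ½`), and DISPLAYED VERBATIM: the co-readings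
`hco`∕`hco1` ((3.42) entries 0, 2 ∕ 1) and `hcoG` (the three (3.47) co-readings), the model hypotheses `hmodel` = {(N06-3-1) `Thm33G0` — THE XL ITEM, (3-2) two `Step`s, (3-3) `FormSmall`,
(3-5) `Identities`}, the left step `hleft` (`LeftStep`, (3.138) differentiated on the left), (N06-3-4) the letters — `hletters` AS ★w1 g2's ONE NAME `LettersRowT3 𝔬 (fun _ ↦ 1) H₀ c35 a₁ M₁ B₃ δ₃`
(✓ p598201) — and the left letters `hlettersD` (`Letters313D` through a free Hölder block norm `bH i` with cutting cost `≤ κ₀`), the SHRUNK residual `hres` = {(3.46) `L2Block`, (3.43)–(3.45)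
`Ineq343_345`} (NO (3.42), NO (3.47)), and the two predicate pins.  Conclusion: `B9.Thm313Printed c35 geo9K bgT3 GG HasRWExp PosDefK` VERBATIM.
§2 ★★★ `normG_row_of_N06d3Obligations` — §1 ∘ `Prop7SectET3NormG.normG_row_of_t313_classTransfer`: the displayed N06(d = 3) obligations of §1 (at the band `b₀ = b₁ = 1` of
`memberIdx`) + ★w1 g2's class-transfer row `ClassTransferT3 ℓ hL c35` (BG-336) + the two (115)-pins of the operator family `Gop` on `GG`'s (3.47) entries ⟹ the displayed `norm_G` row of
`Cmin_of_P6T3_chart_growth_pd` in its own shape, above the M-threshold — the DEPMAP edge «N06(d = 3) obligations → norm_G» as ONE kernel statement with no (3.42)∕(3.47) clause displayed.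
HONEST SCOPE: kernel bookkeeping at d := 2 of LANDED generic theorems; every analytic row stays a hypothesis (Thm 3.3 at curved U is the un-staffed XL node of WANTED №g25-1); N06(d = 3)
is NOT discharged; nothing here claims EX, the crux, V3∕R3, d = 4 or the mass gap.

References: T. Bałaban, CMP **99** (1985) 389–434 [Balaban1985BackgroundPropagators] ((3.41)–(3.42) p.397, (3.47) p.398, Thm 3.3 p.399, (3.130)–(3.138) pp.421–423, (3.147)–(3.153)
pp.425–426, Thm 3.13 p.426); CMP **96** (1984) 223–250 [Balaban1984PropagatorsII] ((2.51)–(2.52) p.232, Lemma 2.1 (2.60)–(2.61) p.234); CMP **102** (1985) 277–309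
[Balaban1985Variational] ((117) p.295); CMP **99** (1985) 75–102 [Balaban1985RegularSpaces] ((1.33) p.82).
-/

set_option autoImplicit false

noncomputable section

open scoped Matrix.Norms.L2Operator

namespace Summit.QuantumFields.YangMills.Theorems.Prop7SectET3N06LeavesCoGlob

open Literature.MathematicalPhysics.QuantumFieldTheory.Balaban1983to89
open Literature.MathematicalPhysics.QuantumFieldTheory.Balaban1983to89.T3ContinuumYM3Torus
open Literature.MathematicalPhysics.QuantumFieldTheory.Balaban1983to89.T3PrintedRegularMinimiser (RegPr)
open Literature.MathematicalPhysics.QuantumFieldTheory.Balaban1983to89.B6KLevelCensusIndexV1 (KIdx)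
open Literature.MathematicalPhysics.QuantumFieldTheory.Balaban1983to89.B6GlobalChartV1 (PV)
open Literature.MathematicalPhysics.QuantumFieldTheory.Balaban1983to89.B9GeoNormsKLevelV1 (geo9K)
open Literature.MathematicalPhysics.QuantumFieldTheory.Balaban1983to89.B9Thm34Ext (toB6)
open Literature.MathematicalPhysics.QuantumFieldTheory.Balaban1983to89.B11SectG (RowSum BlockNorm)
open Literature.MathematicalPhysics.QuantumFieldTheory.Balaban1983to89.B9Thm37GlueCor36 (CoRealizes)
open Literature.MathematicalPhysics.QuantumFieldTheory.Balaban1983to89.B9FromB6 (L2Block)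
open Literature.MathematicalPhysics.QuantumFieldTheory.Balaban1983to89.B9Thm312Whole
  (Ops GeoOK Thm33G0 Step FormSmall Identities HasRWExpOfOps PosDefKOfOps)
open Literature.MathematicalPhysics.QuantumFieldTheory.Balaban1983to89.B9Thm312WholeLeft (LeftStep)
open Literature.MathematicalPhysics.QuantumFieldTheory.Balaban1983to89.B9Thm313Whole (Letters313)
open Literature.MathematicalPhysics.QuantumFieldTheory.Balaban1983to89.B9Thm313WholeLeft (Letters313D)
open Literature.MathematicalPhysics.QuantumFieldTheory.Balaban1983to89.B9Thm313WholeLeafCoGlob (thm313Printed_of_stepDG)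
open Literature.MathematicalPhysics.QuantumFieldTheory.Balaban1983to89.B9Ineq347CoReading (CoReadsGlob)
open Literature.MathematicalPhysics.QuantumFieldTheory.Balaban1983to89.B9GeoLemma21KLevelV1 (rowSum261_geo9K geo9K_one_le_L geo9K_eta_pos)
open Literature.MathematicalPhysics.QuantumFieldTheory.Balaban1983to89.B9GeoNormsKLevelModelSignsV1 (modelSignsOn_geo9K)
open Summit.QuantumFields.YangMills.Theorems.Prop7SectET3Members (hd3 memberIdx)
open Summit.QuantumFields.YangMills.Theorems.Prop7SectET3Geometry (geoOK_geo9K geo9K_L_le lemma21AboveG_geo9K)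
open Summit.QuantumFields.YangMills.Theorems.Prop7SectET3BgClass (bgT3 cfgV1OfT3 ClassTransferT3)
open Summit.QuantumFields.YangMills.Theorems.Prop7SectET3Letters (LettersRowT3)
open Summit.QuantumFields.YangMills.Theorems.Prop7SectET3NormG (normG_row_of_t313_classTransfer)

variable {ℓ : ℕ} {hL : Odd (ℓ + 1) ∧ 1 < ℓ + 1} {b₀ b₁ : ℝ}

/-! ## §1 Theorem 3.13's leaf at the T³ index with (3.42)₁,₂,₃ and (3.47)₀,₁,₂ of 𝔊 proved inside -/

/-- ★★ **THEOREM 3.13's LEAF AT THE T³ INDEX, (3.47) UPGRADE** (Track A's `thm313Printed_of_stepDG` at d + 1 = 3): at `I := KIdx 2 ℓ hd3 hL b₀ b₁`, `geo := geo9K`, `bg := bgT3`, `R₀ ≡ 1`,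
the displayed co-readings `hco` ((3.42)₀,₂ of `GG` by `𝔬.GG U`, `𝔬.GG U ∘ 𝔬.Dstar U`), `hco1` ((3.42)₁ by `𝔬.D U ∘ 𝔬.GG U`) and `hcoG` (the THREE (3.47) CO-READINGS `CoReadsGlob` at the
entries 0, 1, 2 by the same model operators), the model hypotheses `hmodel` (Thm 3.3 for `G₀` at curved `U` — the XL item —, the (3.131)∕(3.138) steps with `θ = θ₁·Mα₀`, the form
smallness with `r = r₁·Mα₀`, the identities), the left step `hleft` (`θ′ = θD·Mα₀`), the letters `hletters` (★w1 g2's ONE NAME `LettersRowT3 𝔬 1 H₀ c35 a₁ M₁ B₃ δ₃`), the left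
letters `hlettersD` (free Hölder block norms `bH i`, cutting cost `≤ κ₀`), the SHRUNK residual `hres` ((3.46) and (3.43)–(3.45) of 𝔊 only) and the two predicate pins give
`B9.Thm313Printed c35 geo9K bgT3 GG HasRWExp PosDefK` — with (3.42)₁,₂,₃ AND (3.47)₀,₁,₂ of 𝔊 PROVED INSIDE (print p. 398 «(3.47) are consequences of (3.42) and Lemma 2.1»).
DISCHARGED here (★w3-20520 g2's rows): `GeoOK`, the model signs, `1 ≤ L ≤ ℓ + 1`, `0 < η`, the row sum (2.61) at rate `σ > 0` (constant floored at 0), `Lemma21AboveG` at `α = ½`.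
[cite: Balaban1985BackgroundPropagators, Thm 3.13 p.426, (3.152)-(3.153) p.426, (3.138) p.423, (3.41)-(3.42) p.397, (3.47) p.398, Thm 3.3 p.399; Balaban1984PropagatorsII, (2.51)-(2.52) p.232, Lemma 2.1 (2.60)-(2.61) p.234] -/
theorem t313_of_pins_T3_coGlob [∀ i : KIdx 2 ℓ hd3 hL b₀ b₁, Fintype (geo9K i).Site]
    {X Y Z W : KIdx 2 ℓ hd3 hL b₀ b₁ → Type} [∀ i, Fintype (X i)] [∀ i, DecidableEq (X i)] [∀ i, Fintype (Y i)] [∀ i, Fintype (Z i)] [∀ i, Fintype (W i)]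
    (𝔬 : ∀ i : KIdx 2 ℓ hd3 hL b₀ b₁, Ops (geo9K i) (bgT3 i) (X i) (Y i) (Z i) (W i)) (H₀ : KIdx 2 ℓ hd3 hL b₀ b₁ → Prop)
    (GG : ∀ i : KIdx 2 ℓ hd3 hL b₀ b₁, B9.KernelFamily (geo9K i) (bgT3 i))
    (bH : ∀ i : KIdx 2 ℓ hd3 hL b₀ b₁, BlockNorm (toB6 (geo9K i) 1 (H₀ i)) (W i → ℝ))
    (HasRWExp : ∀ i : KIdx 2 ℓ hd3 hL b₀ b₁, B9.KernelFamily (geo9K i) (bgT3 i) → (bgT3 i).Cfg → ℝ → Prop)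
    (PosDefK : ∀ i : KIdx 2 ℓ hd3 hL b₀ b₁, B9.KernelFamily (geo9K i) (bgT3 i) → (bgT3 i).Cfg → Prop)
    (ev : ∀ i : KIdx 2 ℓ hd3 hL b₀ b₁, (geo9K i).Loc → X i → ℝ) (evY : ∀ i : KIdx 2 ℓ hd3 hL b₀ b₁, (geo9K i).Loc → Y i → ℝ)
    (c35 θ₁ θD r₁ B₀ δ₀ δK σ ρ a₁ M₁ B₁ δ₁ B₃ δ₃ ρ' κ₀ : ℝ) (Bβ Bε : ℝ → ℝ) (Bεβ : ℝ → ℝ → ℝ)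
    (hθ₁ : 0 ≤ θ₁) (hθD : 0 ≤ θD) (hr₁ : 0 ≤ r₁) (hB₀ : 0 ≤ B₀) (hB₃ : 0 ≤ B₃) (hσ : 0 < σ) (hρ' : 0 < ρ') (hρ'ρ : ρ' + 3 * σ ≤ ρ) (hρS : ρ ≤ δ₀) (hρ₃ : ρ ≤ δ₃)
    (hρδ : ρ + σ ≤ δK) (ha₁ : 0 < a₁) (hM₁ : 0 < M₁) (hδ₁ : 0 < δ₁) (hBβ : ∀ β, 0 ≤ Bβ β) (hBε : ∀ ε, 0 ≤ Bε ε) (hBεβ : ∀ ε β, 0 ≤ Bεβ ε β)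
    (hκ : ∀ i : KIdx 2 ℓ hd3 hL b₀ b₁, (bH i).κ ≤ κ₀)
    (hco : ∀ (i : KIdx 2 ℓ hd3 hL b₀ b₁) (U : (bgT3 i).Cfg),
      CoRealizes (GG i) 0 U (𝔬 i).blk (𝔬 i).blk (ev i) ((𝔬 i).GG U) ∧
      CoRealizes (GG i) 2 U (𝔬 i).blk (𝔬 i).blkY (evY i) ((𝔬 i).GG U ∘ₗ (𝔬 i).Dstar U))
    (hco1 : ∀ (i : KIdx 2 ℓ hd3 hL b₀ b₁) (U : (bgT3 i).Cfg), CoRealizes (GG i) 1 U (𝔬 i).blkY (𝔬 i).blk (ev i) ((𝔬 i).D U ∘ₗ (𝔬 i).GG U))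
    (hcoG : ∀ (i : KIdx 2 ℓ hd3 hL b₀ b₁) (U : (bgT3 i).Cfg),
      CoReadsGlob (GG i) 0 U (𝔬 i).blk (𝔬 i).blk (ev i) ((𝔬 i).GG U) ∧
      CoReadsGlob (GG i) 1 U (𝔬 i).blkY (𝔬 i).blk (ev i) ((𝔬 i).D U ∘ₗ (𝔬 i).GG U) ∧
      CoReadsGlob (GG i) 2 U (𝔬 i).blk (𝔬 i).blkY (evY i) ((𝔬 i).GG U ∘ₗ (𝔬 i).Dstar U))
    (hmodel : ∀ i : KIdx 2 ℓ hd3 hL b₀ b₁, M₁ ≤ (geo9K i).M → ∀ α₀ : ℝ, 0 < α₀ → (geo9K i).M * α₀ ≤ a₁ →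
      ∀ U : (bgT3 i).Cfg, (bgT3 i).Reg335 c35 α₀ U → (bgT3 i).Reg336 c35 α₀ U →
        Thm33G0 (𝔬 i) 1 (H₀ i) B₀ δ₀ U ∧
        Step (𝔬 i) 1 (H₀ i) (geoOK_geo9K i).lenle 1 (θ₁ * ((geo9K i).M * α₀)) δK U ∧
        Step (𝔬 i) 1 (H₀ i) (geoOK_geo9K i).lenle 2 (θ₁ * ((geo9K i).M * α₀)) δK U ∧
        FormSmall (𝔬 i) (r₁ * ((geo9K i).M * α₀)) U ∧ Identities (𝔬 i) U)
    (hleft : ∀ i : KIdx 2 ℓ hd3 hL b₀ b₁, M₁ ≤ (geo9K i).M → ∀ α₀ : ℝ, 0 < α₀ → (geo9K i).M * α₀ ≤ a₁ →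
      ∀ U : (bgT3 i).Cfg, (bgT3 i).Reg335 c35 α₀ U → (bgT3 i).Reg336 c35 α₀ U →
        LeftStep (𝔬 i) 1 (H₀ i) (geoOK_geo9K i).lenle B₀ δ₀ (θD * ((geo9K i).M * α₀)) δK U)
    (hletters : LettersRowT3 𝔬 (fun _ => 1) H₀ c35 a₁ M₁ B₃ δ₃)
    (hlettersD : ∀ i : KIdx 2 ℓ hd3 hL b₀ b₁, M₁ ≤ (geo9K i).M → ∀ α₀ : ℝ, 0 < α₀ → (geo9K i).M * α₀ ≤ a₁ →
      ∀ U : (bgT3 i).Cfg, (bgT3 i).Reg335 c35 α₀ U → (bgT3 i).Reg336 c35 α₀ U →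
        Letters313D (𝔬 i) 1 (H₀ i) (geoOK_geo9K i) B₃ δ₃ (bH i) U)
    (hres : ∀ i : KIdx 2 ℓ hd3 hL b₀ b₁, M₁ ≤ (geo9K i).M → ∀ α₀ : ℝ, 0 < α₀ → (geo9K i).M * α₀ ≤ a₁ →
      ∀ U : (bgT3 i).Cfg, (bgT3 i).Reg335 c35 α₀ U → (bgT3 i).Reg336 c35 α₀ U →
        L2Block (GG i) B₁ δ₁ U ∧ B9.Ineq343_345 (GG i) Bβ Bε Bεβ δ₁ U)
    (hpinE : ∀ i : KIdx 2 ℓ hd3 hL b₀ b₁, HasRWExp i = HasRWExpOfOps (𝔬 i)) (hpinK : ∀ i : KIdx 2 ℓ hd3 hL b₀ b₁, PosDefK i = PosDefKOfOps (𝔬 i)) :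
    B9.Thm313Printed c35 geo9K bgT3 GG HasRWExp PosDefK := by
  have hE : HasRWExp = fun i => HasRWExpOfOps (𝔬 i) := funext hpinE
  have hK : PosDefK = fun i => PosDefKOfOps (𝔬 i) := funext hpinK
  rw [hE, hK]
  -- the generic row sum (2.61) at the rate `σ` (constant floored at `0`) and Lemma 2.1 above threshold at the weight exponent `½`
  obtain ⟨ML, c, hrow⟩ := rowSum261_geo9K (d := 2) (ℓ := ℓ) (hd := hd3) (hL := hL) (b₀ := b₀) (b₁ := b₁) σ hσ
  have hL21 := lemma21AboveG_geo9K (d := 2) (ℓ := ℓ) (hd := hd3) (hL := hL) (b₀ := b₀) (b₁ := b₁) H₀ (α := 1 / 2) (by norm_num) (by norm_num)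
  exact thm313Printed_of_stepDG 𝔬 (fun _ => 1) H₀ GG bH ev evY θ₁ θD r₁ B₀ δ₀ δK σ (max c 0) ρ a₁ M₁ ML B₁ δ₁ B₃ δ₃ ρ' (1 / 2) (((ℓ + 1 : ℕ) : ℝ)) κ₀ Bβ Bε Bεβ
    hθ₁ hθD hr₁ hB₀ hB₃ hσ.le hρ' hρ'ρ hρS hρ₃ hρδ (le_max_right _ _) ha₁ hM₁ hδ₁ hBβ hBε hBεβ (fun i => geoOK_geo9K i) (fun i => modelSignsOn_geo9K i)
    (fun i => geo9K_one_le_L i) (fun i => geo9K_L_le i) (fun i => geo9K_eta_pos i) hκ (fun i hM y => (hrow i hM y).trans (le_max_left _ _)) hL21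
    hco hco1 hcoG hmodel hleft (fun i hM α₀ hα₀ hMa U hU hU' => hletters i hM α₀ hα₀ hMa U hU hU') hlettersD hres

/-! ## §2 The displayed `norm_G` row of C-min from the displayed N06(d = 3) obligations — one kernel statement, no (3.42)∕(3.47) displayed -/

/-- ★★★ **THE `norm_G` ROW OF C-min FROM THE DISPLAYED N06(d = 3) OBLIGATIONS** (§1 ∘ `Prop7SectET3NormG.normG_row_of_t313_classTransfer`): at the band `b₀ = b₁ = 1` of ★w3's
`memberIdx`, the displayed obligations of §1 (co-readings `hco`∕`hco1`∕`hcoG`, `hmodel` with the XL item `Thm33G0`, `hleft`, `hletters = LettersRowT3 …`, `hlettersD`, the shrunk `hres`),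
★w1 g2's class-transfer row `ClassTransferT3 ℓ hL c35` ((BG-336): `RegPr(L³B₃ε₁) ⊂ (3.35) ∧ (3.36)`), and an operator family `Gop i U : Xo i U → Yo i U` read by `GG`'s (3.47) entries
(`hw`: the argument reading `ι` does not increase `|·|_{(−3)}`; `hglob`: `‖Gop i U f‖ ≤ max (glob 0 (ι f) (−3)) (glob 1 (ι f) (−3))`, the (115) jet norm) give `M₄, a₀, B₀ > 0` with:
for every member `memberIdx ℓ hL hℓ m hm n K a' R …` whose `M = L·L^{a'}` clears `M₄`, every `e ≤ a₀∕(L·L^{a'})`, every SU(2) field `U₀ ∈ RegPr ⟨ℓ+1, hL, m, hm⟩ n K e` and every `f`,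
`‖Gop (memberIdx …) (cfgV1OfT3 U₀) f‖ ≤ B₀‖f‖` — the displayed `norm_G` row of `Cmin_of_P6T3_chart_growth_pd` in its shape.  The (3.42)∕(3.47) clauses of 𝔊 are DERIVED, not displayed.
[cite: Balaban1985Variational, (117) p.295; Balaban1985BackgroundPropagators, Thm 3.13 p.426, (3.47) p.398, (3.42) p.397; Balaban1985RegularSpaces, (1.33) p.82; Balaban1984PropagatorsII, Lemma 2.1 (2.60)-(2.61) p.234] -/
theorem normG_row_of_N06d3Obligations [∀ i : KIdx 2 ℓ hd3 hL 1 1, Fintype (geo9K i).Site]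
    {X Y Z W : KIdx 2 ℓ hd3 hL 1 1 → Type} [∀ i, Fintype (X i)] [∀ i, DecidableEq (X i)] [∀ i, Fintype (Y i)] [∀ i, Fintype (Z i)] [∀ i, Fintype (W i)]
    (𝔬 : ∀ i : KIdx 2 ℓ hd3 hL 1 1, Ops (geo9K i) (bgT3 i) (X i) (Y i) (Z i) (W i)) (H₀ : KIdx 2 ℓ hd3 hL 1 1 → Prop)
    (GG : ∀ i : KIdx 2 ℓ hd3 hL 1 1, B9.KernelFamily (geo9K i) (bgT3 i))
    (bH : ∀ i : KIdx 2 ℓ hd3 hL 1 1, BlockNorm (toB6 (geo9K i) 1 (H₀ i)) (W i → ℝ))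
    (ev : ∀ i : KIdx 2 ℓ hd3 hL 1 1, (geo9K i).Loc → X i → ℝ) (evY : ∀ i : KIdx 2 ℓ hd3 hL 1 1, (geo9K i).Loc → Y i → ℝ)
    (c35 θ₁ θD r₁ B₀ δ₀ δK σ ρ a₁ M₁ B₁ δ₁ B₃ δ₃ ρ' κ₀ : ℝ) (Bβ Bε : ℝ → ℝ) (Bεβ : ℝ → ℝ → ℝ)
    (hθ₁ : 0 ≤ θ₁) (hθD : 0 ≤ θD) (hr₁ : 0 ≤ r₁) (hB₀ : 0 ≤ B₀) (hB₃ : 0 ≤ B₃) (hσ : 0 < σ) (hρ' : 0 < ρ') (hρ'ρ : ρ' + 3 * σ ≤ ρ) (hρS : ρ ≤ δ₀) (hρ₃ : ρ ≤ δ₃)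
    (hρδ : ρ + σ ≤ δK) (ha₁ : 0 < a₁) (hM₁ : 0 < M₁) (hδ₁ : 0 < δ₁) (hBβ : ∀ β, 0 ≤ Bβ β) (hBε : ∀ ε, 0 ≤ Bε ε) (hBεβ : ∀ ε β, 0 ≤ Bεβ ε β)
    (hκ : ∀ i : KIdx 2 ℓ hd3 hL 1 1, (bH i).κ ≤ κ₀)
    -- the displayed N06(d = 3) obligations (co-readings, model hypotheses incl. the XL item, left step, letters, left letters, shrunk residual)
    (hco : ∀ (i : KIdx 2 ℓ hd3 hL 1 1) (U : (bgT3 i).Cfg),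
      CoRealizes (GG i) 0 U (𝔬 i).blk (𝔬 i).blk (ev i) ((𝔬 i).GG U) ∧
      CoRealizes (GG i) 2 U (𝔬 i).blk (𝔬 i).blkY (evY i) ((𝔬 i).GG U ∘ₗ (𝔬 i).Dstar U))
    (hco1 : ∀ (i : KIdx 2 ℓ hd3 hL 1 1) (U : (bgT3 i).Cfg), CoRealizes (GG i) 1 U (𝔬 i).blkY (𝔬 i).blk (ev i) ((𝔬 i).D U ∘ₗ (𝔬 i).GG U))
    (hcoG : ∀ (i : KIdx 2 ℓ hd3 hL 1 1) (U : (bgT3 i).Cfg),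
      CoReadsGlob (GG i) 0 U (𝔬 i).blk (𝔬 i).blk (ev i) ((𝔬 i).GG U) ∧
      CoReadsGlob (GG i) 1 U (𝔬 i).blkY (𝔬 i).blk (ev i) ((𝔬 i).D U ∘ₗ (𝔬 i).GG U) ∧
      CoReadsGlob (GG i) 2 U (𝔬 i).blk (𝔬 i).blkY (evY i) ((𝔬 i).GG U ∘ₗ (𝔬 i).Dstar U))
    (hmodel : ∀ i : KIdx 2 ℓ hd3 hL 1 1, M₁ ≤ (geo9K i).M → ∀ α₀ : ℝ, 0 < α₀ → (geo9K i).M * α₀ ≤ a₁ →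
      ∀ U : (bgT3 i).Cfg, (bgT3 i).Reg335 c35 α₀ U → (bgT3 i).Reg336 c35 α₀ U →
        Thm33G0 (𝔬 i) 1 (H₀ i) B₀ δ₀ U ∧
        Step (𝔬 i) 1 (H₀ i) (geoOK_geo9K i).lenle 1 (θ₁ * ((geo9K i).M * α₀)) δK U ∧
        Step (𝔬 i) 1 (H₀ i) (geoOK_geo9K i).lenle 2 (θ₁ * ((geo9K i).M * α₀)) δK U ∧
        FormSmall (𝔬 i) (r₁ * ((geo9K i).M * α₀)) U ∧ Identities (𝔬 i) U)
    (hleft : ∀ i : KIdx 2 ℓ hd3 hL 1 1, M₁ ≤ (geo9K i).M → ∀ α₀ : ℝ, 0 < α₀ → (geo9K i).M * α₀ ≤ a₁ →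
      ∀ U : (bgT3 i).Cfg, (bgT3 i).Reg335 c35 α₀ U → (bgT3 i).Reg336 c35 α₀ U →
        LeftStep (𝔬 i) 1 (H₀ i) (geoOK_geo9K i).lenle B₀ δ₀ (θD * ((geo9K i).M * α₀)) δK U)
    (hletters : LettersRowT3 𝔬 (fun _ => 1) H₀ c35 a₁ M₁ B₃ δ₃)
    (hlettersD : ∀ i : KIdx 2 ℓ hd3 hL 1 1, M₁ ≤ (geo9K i).M → ∀ α₀ : ℝ, 0 < α₀ → (geo9K i).M * α₀ ≤ a₁ →
      ∀ U : (bgT3 i).Cfg, (bgT3 i).Reg335 c35 α₀ U → (bgT3 i).Reg336 c35 α₀ U →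
        Letters313D (𝔬 i) 1 (H₀ i) (geoOK_geo9K i) B₃ δ₃ (bH i) U)
    (hres : ∀ i : KIdx 2 ℓ hd3 hL 1 1, M₁ ≤ (geo9K i).M → ∀ α₀ : ℝ, 0 < α₀ → (geo9K i).M * α₀ ≤ a₁ →
      ∀ U : (bgT3 i).Cfg, (bgT3 i).Reg335 c35 α₀ U → (bgT3 i).Reg336 c35 α₀ U →
        L2Block (GG i) B₁ δ₁ U ∧ B9.Ineq343_345 (GG i) Bβ Bε Bεβ δ₁ U)
    -- the class-transfer row (BG-336)
    (hCT : ClassTransferT3 ℓ hL c35)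
    -- the operator family read by `GG`'s (3.47) entries at `γ = −3` (the two (115)-pins)
    {Xo Yo : ∀ i : KIdx 2 ℓ hd3 hL 1 1, (bgT3 i).Cfg → Type} [∀ i U, SeminormedAddCommGroup (Xo i U)] [∀ i U, SeminormedAddCommGroup (Yo i U)]
    (Gop : ∀ (i : KIdx 2 ℓ hd3 hL 1 1) (U : (bgT3 i).Cfg), Xo i U → Yo i U) (ι : ∀ (i : KIdx 2 ℓ hd3 hL 1 1) (U : (bgT3 i).Cfg), Xo i U → (geo9K i).Loc)
    (hw : ∀ (i : KIdx 2 ℓ hd3 hL 1 1) (U : (bgT3 i).Cfg) (f : Xo i U), (geo9K i).wNorm (-3) (ι i U f) ≤ ‖f‖)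
    (hglob : ∀ (i : KIdx 2 ℓ hd3 hL 1 1) (U : (bgT3 i).Cfg) (f : Xo i U), ‖Gop i U f‖ ≤ max ((GG i).glob 0 U (ι i U f) (-3)) ((GG i).glob 1 U (ι i U f) (-3))) :
    ∃ M₄ a₀ B₀' : ℝ, 0 < M₄ ∧ 0 < a₀ ∧ 0 < B₀' ∧
      ∀ (hℓ : 4 ≤ ℓ) (m : ℕ) (hm : 1 ≤ m) (n K a' R : ℕ) (hk1 : 1 ≤ K - n) (hsize : a' + 3 ≤ m + n) (hM8 : 8 ≤ (ℓ + 1) ^ a') (hR2 : 2 * (ℓ + 1) ^ 2 ≤ R),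
        M₄ ≤ ((ℓ + 1 : ℕ) : ℝ) * (((ℓ + 1) ^ a' : ℕ) : ℝ) →
        ∀ (e : ℝ) (U₀ : GaugeField (PV 2 ℓ m K hd3 hL) 0 (Matrix.specialUnitaryGroup (Fin 2) ℂ)),
          RegPr (⟨ℓ + 1, hL, m, hm⟩ : T3Family) n K e U₀ → e ≤ a₀ / (((ℓ + 1 : ℕ) : ℝ) * (((ℓ + 1) ^ a' : ℕ) : ℝ)) →
            ∀ f : Xo (memberIdx ℓ hL hℓ m hm n K a' R hk1 hsize hM8 hR2) (cfgV1OfT3 U₀),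
              ‖Gop (memberIdx ℓ hL hℓ m hm n K a' R hk1 hsize hM8 hR2) (cfgV1OfT3 U₀) f‖ ≤ B₀' * ‖f‖ :=
  normG_row_of_t313_classTransfer
    (t313_of_pins_T3_coGlob 𝔬 H₀ GG bH (fun i => HasRWExpOfOps (𝔬 i)) (fun i => PosDefKOfOps (𝔬 i)) ev evY c35 θ₁ θD r₁ B₀ δ₀ δK σ ρ a₁ M₁ B₁ δ₁ B₃ δ₃ ρ' κ₀ Bβ Bε Bεβ
      hθ₁ hθD hr₁ hB₀ hB₃ hσ hρ' hρ'ρ hρS hρ₃ hρδ ha₁ hM₁ hδ₁ hBβ hBε hBεβ hκ hco hco1 hcoG hmodel hleft hletters hlettersD hres (fun _ => rfl) (fun _ => rfl))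
    hCT Gop ι hw hglob

end Summit.QuantumFields.YangMills.Theorems.Prop7SectET3N06LeavesCoGlob

end
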